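import Summits.CriticalPhenomena.SAWScalingLimit.Theorems.SAWDefectDecoherenceObservableToSLERTwoPieceAdmIdentificationClauses
import Summits.CriticalPhenomena.SAWScalingLimit.Theorems.SAWDevelopingMapObservableToSLECanonicalTransferExhaustion
import Literature.Probability.RandomPlanarGeometry.ConformalRestrictionProofs
import HarnessLib

/-!
# Crux `SAWDefectDecoherence.ObservableToSLER` (stmt-CriticalPhenomena-14005), line
`bridge-gate-renewal` (r7), stub 5a3 `stub_twoPieceAdmIdentification`: THE ADMISSIBLE SUB-FAMILY
of a given admissible family, for a hull subdomain and an exclusion set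

Landing target:
`Summits/CriticalPhenomena/SAWScalingLimit/Theorems/SAWDefectDecoherenceObservableToSLERTwoPieceAdmIdentificationFamily.lean`
(`--supports stmt-CriticalPhenomena-14005`).  Sequel of `…TwoPieceAdmIdentificationClauses`.

`exists_admissible_subFamily`: for a two-piece flat Dobrushin domain `(M; a, b)`, a hull subdomain
`M'`, an admissible family `Λ δ` in the sense of `HexObservableLimitR`, and a compact EXCLUSION SET
`T` off the marked points with `M ∖ M' ⊆ T`, `T ∩ M' = ∅`, escapable to the floor at `pt 1`, the
sub-families `Λ' δ` (component of the inner end of `a δ` in the deep vertices of `Λ δ`,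
`…Component`) form, eventually as `δ → 0⁺`, an admissible pair `(Λ δ, Λ' δ)` for `(M, M')` in the
sense of the two-piece admissible restriction limit at some radius `ρ' ≤ ρ`; `Λ' δ` exhausts the
compacts of `M'` (compact cores, `FloorRatio.exists_walk_deep_of_isCompact`); and (LOWER SANDWICH
INCLUSION) for every `r > 0`, eventually every walk `γ ⊂ Λ δ : a δ → b δ` staying `r`-away from
`T` is a walk of `Λ' δ`.
-/

noncomputable section

open scoped Topology Classical
open Filter Set Metric
open Literature.Probability.LatticeModels (HexVertex hexGraph hexCenter Site polyline)
open Literature.Probability.RandomPlanarGeometry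
open Literature.Probability.RandomPlanarGeometry.SAW
open Literature.Probability.Percolation (PathIn)

namespace Summit.CriticalPhenomena.SAWScalingLimit.Theorems.ObservableToSLER.TwoPiece

open Summit.CriticalPhenomena.SAWScalingLimit.Theorems.ObservableToSLE.FloorRatio

/-- The points at distance `≥ r > 0` from the complement of a bounded open set form a compact
subset of it. [folklore] -/
theorem isCompact_setOf_le_infDist_compl {U : Set ℂ} (hU : Bornology.IsBounded U) {r : ℝ}
    (hr : 0 < r) :
    IsCompact {z : ℂ | r ≤ infDist z Uᶜ} ∧ {z : ℂ | r ≤ infDist z Uᶜ} ⊆ U := by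
  have hsub : {z : ℂ | r ≤ infDist z Uᶜ} ⊆ U := fun z hz => by
    by_contra h
    have : infDist z Uᶜ = 0 := infDist_zero_of_mem h
    simp only [mem_setOf_eq, this] at hz
    linarith
  exact ⟨Metric.isCompact_of_isClosed_isBounded
    (isClosed_le continuous_const (continuous_infDist_pt _)) (hU.subset hsub), hsub⟩

/-- A closed ball inside `U` puts its centre at distance `≥ r` from `Uᶜ`. [folklore] -/
theorem le_infDist_compl_of_closedBall_subset {U : Set ℂ} (hne : Uᶜ.Nonempty) {z : ℂ} {r : ℝ}
    (h : closedBall z r ⊆ U) : r ≤ infDist z Uᶜ := by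
  rw [le_infDist hne]
  intro y hy
  by_contra hlt
  push Not at hlt
  exact hy (h (mem_closedBall.2 (by rw [dist_comm]; exact hlt.le)))

/-- **THE ADMISSIBLE SUB-FAMILY** (see the module docstring).
[cite: DuminilCopinSmirnov2012, §4 (before Conjecture 1); LawlerSchrammWerner2004SAW, §3.4] -/
theorem exists_admissible_subFamily {M M' : DobrushinDomain} {ρ : ℝ}
    {Λ : ℝ → Finset HexVertex} {m : Fin 2 → ℝ → ℤ} {a b : ℝ → Sym2 HexVertex} {T : Set ℂ}
    (hflat : 0 < ρ ∧ ∀ i : Fin 2, M.carrier ∩ ball (M.pt i) ρ =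
      {z : ℂ | (M.pt i).im < z.im} ∩ ball (M.pt i) ρ)
    (hM' : M.IsHullSubdomain M')
    (hadm : ∀ᶠ δ : ℝ in 𝓝[>] 0, hexDomainSimplyConnected (Λ δ) ∧ a δ ∈ hexDomainBoundary (Λ δ) ∧
      b δ ∈ hexDomainBoundary (Λ δ) ∧ Nonempty (HexMidEdgeSAW (Λ δ) (a δ) (b δ)) ∧
      (hexGraph.induce (↑(Λ δ) : Set HexVertex)).Preconnected ∧
      (∀ v ∈ Λ δ, (δ : ℂ) * hexCenter v ∈ M.carrier) ∧
      (∀ i : Fin 2, ∀ v : HexVertex, (δ : ℂ) * hexCenter v ∈ ball (M.pt i) ρ →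
        (v ∈ Λ δ ↔ m i δ ≤ v.1 1)))
    (hexh : ∀ K : Set ℂ, IsCompact K → K ⊆ M.carrier →
      ∀ᶠ δ : ℝ in 𝓝[>] 0, ∀ v : HexVertex, (δ : ℂ) * hexCenter v ∈ K → v ∈ Λ δ)
    (ha : Tendsto (fun δ : ℝ => (δ : ℂ) * hexMidpoint (a δ)) (𝓝[>] 0) (𝓝 (M.pt 0)))
    (hb : Tendsto (fun δ : ℝ => (δ : ℂ) * hexMidpoint (b δ)) (𝓝[>] 0) (𝓝 (M.pt 1)))
    (hTc : IsCompact T) (hT0 : M.pt 0 ∉ T) (hT1 : M.pt 1 ∉ T)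
    (hTdiff : M.carrier \ M'.carrier ⊆ T) (hTdisj : Disjoint T M'.carrier)
    (hTesc : ∀ y ∈ T, ∃ Ty ⊆ T, IsPreconnected Ty ∧ y ∈ Ty ∧
      ∃ q ∈ Ty, q.im = (M.pt 1).im ∧ dist q (M.pt 1) < ρ / 4) :
    ∃ (Λ' : ℝ → Finset HexVertex) (ρ' : ℝ), 0 < ρ' ∧ ρ' ≤ ρ ∧
      (∀ᶠ δ : ℝ in 𝓝[>] 0,
        Λ' δ ⊆ Λ δ ∧ hexDomainSimplyConnected (Λ δ) ∧ hexDomainSimplyConnected (Λ' δ) ∧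
        (hexGraph.induce (↑(Λ δ) : Set HexVertex)).Preconnected ∧
        (hexGraph.induce (↑(Λ' δ) : Set HexVertex)).Preconnected ∧
        a δ ∈ hexDomainBoundary (Λ δ) ∧ b δ ∈ hexDomainBoundary (Λ δ) ∧
        a δ ∈ hexDomainBoundary (Λ' δ) ∧ b δ ∈ hexDomainBoundary (Λ' δ) ∧
        Nonempty (HexMidEdgeSAW (Λ' δ) (a δ) (b δ)) ∧
        (∀ v ∈ Λ δ, (δ : ℂ) * hexCenter v ∈ M.carrier) ∧
        (∀ v ∈ Λ' δ, (δ : ℂ) * hexCenter v ∈ M'.carrier) ∧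
        (∀ v : HexVertex, (δ : ℂ) * hexCenter v ∈ ball (M.pt 0) ρ' →
          ((v ∈ Λ δ ↔ m 0 δ ≤ v.1 1) ∧ (v ∈ Λ' δ ↔ m 0 δ ≤ v.1 1))) ∧
        (∀ v : HexVertex, (δ : ℂ) * hexCenter v ∈ ball (M.pt 1) ρ' →
          ((v ∈ Λ δ ↔ m 1 δ ≤ v.1 1) ∧ (v ∈ Λ' δ ↔ m 1 δ ≤ v.1 1)))) ∧
      (∀ K : Set ℂ, IsCompact K → K ⊆ M'.carrier →
        ∀ᶠ δ : ℝ in 𝓝[>] 0, ∀ v : HexVertex, (δ : ℂ) * hexCenter v ∈ K → v ∈ Λ' δ) ∧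
      (∀ r : ℝ, 0 < r → ∀ᶠ δ : ℝ in 𝓝[>] 0, ∀ γ : HexMidEdgeSAW (Λ δ) (a δ) (b δ),
        (∀ v ∈ γ.verts, ∀ y ∈ T, r ≤ dist ((δ : ℂ) * hexCenter v) y) →
          ∀ v ∈ γ.verts, v ∈ Λ' δ) := by
  obtain ⟨hρ, hflat'⟩ := hflat
  set p₀ : ℂ := M.pt 0 with hp₀
  set p₁ : ℂ := M.pt 1 with hp₁
  have hflat₀ : M.carrier ∩ ball p₀ ρ = {z : ℂ | p₀.im < z.im} ∩ ball p₀ ρ := hflat' 0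
  have hflat₁ : M.carrier ∩ ball p₁ ρ = {z : ℂ | p₁.im < z.im} ∩ ball p₁ ρ := hflat' 1
  have hsub : M'.carrier ⊆ M.carrier := hM'.carrier_subset
  -- (B) near the marked points `M'` agrees with `M`
  obtain ⟨ϱ₀, hϱ₀, hϱ₀M⟩ : ∃ ϱ₀ > 0, (∀ z, dist z p₀ < ϱ₀ → z ∈ M.carrier → z ∈ M'.carrier) ∧
      (∀ z, dist z p₁ < ϱ₀ → z ∈ M.carrier → z ∈ M'.carrier) := by
    obtain ⟨ε₀, hε₀, h₀⟩ := Metric.eventually_nhds_iff.1 (hM'.eventually_mem 0)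
    obtain ⟨ε₁, hε₁, h₁⟩ := Metric.eventually_nhds_iff.1 (hM'.eventually_mem 1)
    exact ⟨min ε₀ ε₁, lt_min hε₀ hε₁, fun z hz => h₀ (hz.trans_le (min_le_left _ _)),
      fun z hz => h₁ (hz.trans_le (min_le_right _ _))⟩
  -- (C) `T` stays away from the marked points
  obtain ⟨τ, hτ, hτT⟩ : ∃ τ > 0, ∀ y ∈ T, τ ≤ dist y p₀ ∧ τ ≤ dist y p₁ := by
    rcases T.eq_empty_or_nonempty with hTe | hTne
    · exact ⟨1, one_pos, fun y hy => by rw [hTe] at hy; exact absurd hy (notMem_empty _)⟩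
    · have h0 : 0 < infDist p₀ T := (hTc.isClosed.notMem_iff_infDist_pos hTne).1 hT0
      have h1 : 0 < infDist p₁ T := (hTc.isClosed.notMem_iff_infDist_pos hTne).1 hT1
      refine ⟨min (infDist p₀ T) (infDist p₁ T), lt_min h0 h1, fun y hy => ⟨?_, ?_⟩⟩
      · rw [dist_comm]; exact (min_le_left _ _).trans (infDist_le_dist_of_mem hy)
      · rw [dist_comm]; exact (min_le_right _ _).trans (infDist_le_dist_of_mem hy)
  -- (D) the flat scale `L`
  have hd01 : 0 < dist p₀ p₁ := dist_pos.2 fun h => absurd (M.pt_injective h) (by decide)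
  set L : ℝ := min (min (τ / 4) (ρ / 4)) (min (ϱ₀ / 2) (dist p₀ p₁)) with hLdef
  have hL : 0 < L := lt_min (lt_min (by positivity) (by positivity)) (lt_min (by positivity) hd01)
  have hL1 : L ≤ min (τ / 4) (ρ / 4) := min_le_left _ _
  have hL2 : L ≤ min (ϱ₀ / 2) (dist p₀ p₁) := min_le_right _ _
  have hLτ : 4 * L ≤ τ := by linarith [hL1.trans (min_le_left _ _)]
  have hLρ : 4 * L ≤ ρ := by linarith [hL1.trans (min_le_right _ _)]
  have hLϱ : 2 * L ≤ ϱ₀ := by linarith [hL2.trans (min_le_left _ _)]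
  have hLd : L ≤ dist p₀ p₁ := hL2.trans (min_le_right _ _)
  have hTfar₀ : ∀ y ∈ T, 4 * L ≤ dist y p₀ := fun y hy => hLτ.trans (hτT y hy).1
  have hTfar₁ : ∀ y ∈ T, 4 * L ≤ dist y p₁ := fun y hy => hLτ.trans (hτT y hy).2
  -- points of the flat zones
  have hmemM : ∀ {p : ℂ} {z : ℂ}, M.carrier ∩ ball p ρ = {z : ℂ | p.im < z.im} ∩ ball p ρ →
      p.im < z.im → dist z p < ρ → z ∈ M.carrier := by
    intro p z hfl hzim hzp
    have : z ∈ {z : ℂ | p.im < z.im} ∩ ball p ρ := ⟨hzim, mem_ball.2 hzp⟩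
    rw [← hfl] at this
    exact this.1
  have hnorm_LI : ‖(L : ℂ) * Complex.I‖ = L := by
    rw [norm_mul, Complex.norm_real, Complex.norm_I, mul_one, Real.norm_of_nonneg hL.le]
  -- the hubs `x_i = pt i + iL` and the target disc `K₁` lie in `M'`
  have hball_sub : ∀ {p : ℂ} {c : ℂ} {s : ℝ},
      M.carrier ∩ ball p ρ = {z : ℂ | p.im < z.im} ∩ ball p ρ →
      (∀ z, dist z p < ϱ₀ → z ∈ M.carrier → z ∈ M'.carrier) →
      dist c p ≤ L → p.im + L ≤ c.im → 0 ≤ s → s ≤ L / 4 →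
      closedBall c s ⊆ M'.carrier := by
    intro p c s hfl hϱ hcp hcim hs hsL z hz
    rw [mem_closedBall] at hz
    have hzp : dist z p < 2 * L := by
      have := dist_triangle z c p; linarith
    have hzim : p.im < z.im := by
      have him := Complex.abs_im_le_norm (z - c)
      rw [← dist_eq_norm, Complex.sub_im] at him
      have := (abs_le.1 (him.trans hz)).1
      linarith
    exact hϱ z (by linarith) (hmemM hfl hzim (by linarith))
  have hx₀dist : dist (p₀ + (L : ℂ) * Complex.I) p₀ ≤ L := by
    rw [dist_eq_norm, add_sub_cancel_left, hnorm_LI]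
  have hx₁dist : dist (p₁ + (L : ℂ) * Complex.I) p₁ ≤ L := by
    rw [dist_eq_norm, add_sub_cancel_left, hnorm_LI]
  have hx₀M' : p₀ + (L : ℂ) * Complex.I ∈ M'.carrier :=
    hball_sub hflat₀ hϱ₀M.1 hx₀dist (by simp) le_rfl (by linarith) (mem_closedBall_self le_rfl)
  have hK₁M' : closedBall (p₁ + (L : ℂ) * Complex.I) (L / 8) ⊆ M'.carrier :=
    hball_sub hflat₁ hϱ₀M.2 hx₁dist (by simp) (by linarith) (by linarith)
  obtain ⟨ε₁, hε₁, H₁⟩ := exists_walk_deep_of_isCompact M'.isOpen M'.isConnected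
    (isCompact_closedBall _ _) hK₁M' hx₀M'
  have hM'b : Bornology.IsBounded M'.carrier := M'.isBounded
  have hM'cne : M'.carrierᶜ.Nonempty := by
    rw [nonempty_compl]; exact M'.toJordanDomain.carrier_ne_univ
  -- eventual facts
  have e0 : ∀ᶠ δ : ℝ in 𝓝[>] 0, 0 < δ ∧ δ ≤ min (L / 16) (ε₁ / 10) := by
    have h1 : ∀ᶠ δ : ℝ in 𝓝[>] 0, δ ∈ Ioo 0 (min (L / 16) (ε₁ / 10)) :=
      Ioo_mem_nhdsGT (lt_min (by positivity) (by positivity))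
    filter_upwards [h1] with δ hδ
    exact ⟨hδ.1, hδ.2.le⟩
  have ea : ∀ᶠ δ : ℝ in 𝓝[>] 0, dist ((δ : ℂ) * hexMidpoint (a δ)) p₀ < L / 16 :=
    ha (ball_mem_nhds _ (by positivity))
  have eb : ∀ᶠ δ : ℝ in 𝓝[>] 0, dist ((δ : ℂ) * hexMidpoint (b δ)) p₁ < L / 16 :=
    hb (ball_mem_nhds _ (by positivity))
  -- the small discs above the marked points are compacts of `M`
  have hdisc : ∀ {p : ℂ}, M.carrier ∩ ball p ρ = {z : ℂ | p.im < z.im} ∩ ball p ρ →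
      closedBall (p + ((L / 4 : ℝ) : ℂ) * Complex.I) (L / 8) ⊆ M.carrier := by
    intro p hfl z hz
    rw [mem_closedBall] at hz
    have hc : dist (p + ((L / 4 : ℝ) : ℂ) * Complex.I) p = L / 4 := by
      rw [dist_eq_norm, add_sub_cancel_left, norm_mul, Complex.norm_real, Complex.norm_I,
        mul_one, Real.norm_of_nonneg (by linarith)]
    have hcim : (p + ((L / 4 : ℝ) : ℂ) * Complex.I).im = p.im + L / 4 := by simp
    refine hmemM hfl ?_ ?_
    · have him := Complex.abs_im_le_norm (z - (p + ((L / 4 : ℝ) : ℂ) * Complex.I))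
      rw [← dist_eq_norm, Complex.sub_im, hcim] at him
      have := (abs_le.1 (him.trans hz)).1
      linarith
    · have := dist_triangle z (p + ((L / 4 : ℝ) : ℂ) * Complex.I) p
      linarith
  have eK₀ := hexh _ (isCompact_closedBall _ _) (hdisc hflat₀)
  have eK₁ := hexh _ (isCompact_closedBall _ _) (hdisc hflat₁)
  obtain ⟨hKc₁, hKc₁sub⟩ := isCompact_setOf_le_infDist_compl hM'b (half_pos hε₁)
  have eKc₁ := hexh _ hKc₁ (hKc₁sub.trans hsub)
  -- FLOOR LOW: the threshold height of the floor row is `≤ Im p + L/2`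
  have hfloor : ∀ {p : ℂ} {δ : ℝ} {mm : ℤ}, 0 < δ → δ ≤ L / 16 →
      (∀ v : HexVertex, (δ : ℂ) * hexCenter v ∈ closedBall (p + ((L / 4 : ℝ) : ℂ) * Complex.I)
        (L / 8) → v ∈ Λ δ) →
      (∀ v : HexVertex, (δ : ℂ) * hexCenter v ∈ ball p ρ → (v ∈ Λ δ ↔ mm ≤ v.1 1)) →
      ((mm : ℝ) + 1 / 3) * (δ * (Real.sqrt 3 / 2)) ≤ p.im + L / 2 := by
    intro p δ mm hδ hδL hK hrow
    obtain ⟨v, hv⟩ := exists_vertex_dist_le hδ (p + ((L / 4 : ℝ) : ℂ) * Complex.I)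
    have hvK : (δ : ℂ) * hexCenter v ∈ closedBall (p + ((L / 4 : ℝ) : ℂ) * Complex.I) (L / 8) :=
      mem_closedBall.2 (hv.trans (by linarith))
    have hvΛ := hK v hvK
    have hcim : (p + ((L / 4 : ℝ) : ℂ) * Complex.I).im = p.im + L / 4 := by simp
    have hvball : (δ : ℂ) * hexCenter v ∈ ball p ρ := by
      rw [mem_ball]
      have hc : dist (p + ((L / 4 : ℝ) : ℂ) * Complex.I) p = L / 4 := by
        rw [dist_eq_norm, add_sub_cancel_left, norm_mul, Complex.norm_real, Complex.norm_I,
          mul_one, Real.norm_of_nonneg (by linarith)]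
      have := dist_triangle ((δ : ℂ) * hexCenter v) (p + ((L / 4 : ℝ) : ℂ) * Complex.I) p
      linarith
    have hH := (row_le_iff_im hδ mm v).1 ((hrow v hvball).1 hvΛ)
    have him := Complex.abs_im_le_norm ((δ : ℂ) * hexCenter v - (p + ((L / 4 : ℝ) : ℂ) * Complex.I))
    rw [← dist_eq_norm, Complex.sub_im, hcim] at him
    have := (abs_le.1 (him.trans hv)).2
    linarith
  -- the ends of the boundary mid-edges `a δ`, `b δ` (chosen; junk where not boundary mid-edges)
  have hend : ∀ (e : ℝ → Sym2 HexVertex) (δ : ℝ), ∃ u v : HexVertex,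
      e δ ∈ hexDomainBoundary (Λ δ) → e δ = s(u, v) ∧ v ∈ Λ δ ∧ u ∉ Λ δ ∧ hexGraph.Adj u v := by
    intro e δ
    by_cases h : e δ ∈ hexDomainBoundary (Λ δ)
    · obtain ⟨u, v, h'⟩ := exists_ends_of_mem_hexDomainBoundary h
      exact ⟨u, v, fun _ => h'⟩
    · exact ⟨default, default, fun h' => absurd h' h⟩
  choose ua va hva_spec using hend a
  choose ub vb hvb_spec using hend b
  -- vertices of a deep walk of `M'` are deep vertices of `Λ δ`
  have walk_deep : ∀ {δ ε : ℝ} {u : HexVertex}, 0 < δ → δ ≤ ε / 10 →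
      (∀ v : HexVertex, (δ : ℂ) * hexCenter v ∈ {z : ℂ | ε / 2 ≤ infDist z M'.carrierᶜ} →
        v ∈ Λ δ) →
      closedBall ((δ : ℂ) * hexCenter u) (ε - 4 * δ) ⊆ M'.carrier → u ∈ {u : HexVertex | u ∈ Λ δ ∧ ∀ y ∈ T, 6 * δ < dist ((δ : ℂ) * hexCenter u) y} := by
    intro δ ε u hδ hδε hKc hu
    refine ⟨hKc u ?_, fun y hy => ?_⟩
    · exact le_trans (by linarith) (le_infDist_compl_of_closedBall_subset hM'cne hu)
    · by_contra hle
      push Not at hle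
      have hyM' : y ∈ M'.carrier := hu (mem_closedBall.2 (by rw [dist_comm]; linarith))
      exact Set.disjoint_left.1 hTdisj hy hyM'
  -- THE MASTER EVENTUAL STATEMENT at a good mesh
  have master : ∀ᶠ δ : ℝ in 𝓝[>] 0, 0 < δ ∧ 16 * δ ≤ L ∧
      (hexDomainSimplyConnected (Λ δ) ∧ a δ ∈ hexDomainBoundary (Λ δ) ∧
        b δ ∈ hexDomainBoundary (Λ δ) ∧ Nonempty (HexMidEdgeSAW (Λ δ) (a δ) (b δ)) ∧
        (hexGraph.induce (↑(Λ δ) : Set HexVertex)).Preconnected ∧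
        (∀ v ∈ Λ δ, (δ : ℂ) * hexCenter v ∈ M.carrier) ∧
        (∀ i : Fin 2, ∀ v : HexVertex, (δ : ℂ) * hexCenter v ∈ ball (M.pt i) ρ →
          (v ∈ Λ δ ↔ m i δ ≤ v.1 1))) ∧
      a δ ≠ b δ ∧
      dist ((δ : ℂ) * hexCenter (va δ)) p₀ ≤ L / 8 ∧
      dist ((δ : ℂ) * hexCenter (vb δ)) p₁ ≤ L / 8 ∧
      ((m 0 δ : ℝ) + 1 / 3) * (δ * (Real.sqrt 3 / 2)) ≤ p₀.im + L / 2 ∧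
      ((m 1 δ : ℝ) + 1 / 3) * (δ * (Real.sqrt 3 / 2)) ≤ p₁.im + L / 2 ∧
      (∀ z : HexVertex, dist ((δ : ℂ) * hexCenter z) (p₁ + (L : ℂ) * Complex.I) ≤ δ →
        PathIn hexGraph {u : HexVertex | u ∈ Λ δ ∧ ∀ y ∈ T, 6 * δ < dist ((δ : ℂ) * hexCenter u) y} (va δ) z) := by
    filter_upwards [e0, hadm, ea, eb, eK₀, eK₁, eKc₁] with δ hδ hA hea heb hK₀ hK₁ hKc
    obtain ⟨hδ, hδle⟩ := hδ
    have hδL : δ ≤ L / 16 := hδle.trans (min_le_left _ _)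
    have hδε : δ ≤ ε₁ / 10 := hδle.trans (min_le_right _ _)
    have hA' := hA
    obtain ⟨-, haB, hbB, -, -, -, hrows⟩ := hA'
    have hrow₀ := hrows 0
    have hrow₁ := hrows 1
    -- inner ends near the marked points
    obtain ⟨heqa, hvaΛ, -, hadja⟩ := hva_spec δ haB
    obtain ⟨heqb, hvbΛ, -, hadjb⟩ := hvb_spec δ hbB
    have hva : dist ((δ : ℂ) * hexCenter (va δ)) p₀ ≤ L / 8 := by
      have h1 := dist_smul_center_midpoint_le hδ.le hadja
      rw [← heqa] at h1
      have := dist_triangle ((δ : ℂ) * hexCenter (va δ)) ((δ : ℂ) * hexMidpoint (a δ)) p₀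
      linarith
    have hvb : dist ((δ : ℂ) * hexCenter (vb δ)) p₁ ≤ L / 8 := by
      have h1 := dist_smul_center_midpoint_le hδ.le hadjb
      rw [← heqb] at h1
      have := dist_triangle ((δ : ℂ) * hexCenter (vb δ)) ((δ : ℂ) * hexMidpoint (b δ)) p₁
      linarith
    -- `a δ ≠ b δ`: their rescaled midpoints are near the two distinct marked points
    have hab : a δ ≠ b δ := by
      intro h
      have := dist_triangle p₀ ((δ : ℂ) * hexMidpoint (a δ)) p₁
      rw [dist_comm p₀ ((δ : ℂ) * hexMidpoint (a δ))] at this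
      rw [h] at this hea
      linarith
    have hH₀ : ((m 0 δ : ℝ) + 1 / 3) * (δ * (Real.sqrt 3 / 2)) ≤ p₀.im + L / 2 :=
      hfloor hδ hδL hK₀ hrow₀
    have hH₁ : ((m 1 δ : ℝ) + 1 / 3) * (δ * (Real.sqrt 3 / 2)) ≤ p₁.im + L / 2 :=
      hfloor hδ hδL hK₁ hrow₁
    -- the hub link through the compact core of `M'`
    have hlink : ∀ z : HexVertex, dist ((δ : ℂ) * hexCenter z) (p₁ + (L : ℂ) * Complex.I) ≤ δ →
        PathIn hexGraph {u : HexVertex | u ∈ Λ δ ∧ ∀ y ∈ T, 6 * δ < dist ((δ : ℂ) * hexCenter u) y} (va δ) z := by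
      intro z hz
      obtain ⟨z₀, hz₀⟩ := exists_vertex_dist_le hδ (p₀ + (L : ℂ) * Complex.I)
      have h1 : PathIn hexGraph {u : HexVertex | u ∈ Λ δ ∧ ∀ y ∈ T, 6 * δ < dist ((δ : ℂ) * hexCenter u) y} (va δ) z₀ :=
        pathIn_deepSet_of_low hδ (by linarith) hLρ hrow₀ hTfar₀ hH₀ hva hvaΛ hz₀
      obtain ⟨w, hw⟩ := H₁ δ (ε₁ - 4 * δ) hδ (by linarith) z₀ z hz₀
        (mem_closedBall.2 (hz.trans (by linarith)))
      refine h1.trans (pathIn_of_walk w fun u hu => walk_deep hδ hδε hKc (hw u hu))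
    exact ⟨hδ, by linarith, hA, hab, hva, hvb, hH₀, hH₁, hlink⟩
  -- THE CONCLUSIONS
  refine ⟨fun δ => ((Λ δ).filter fun z => PathIn hexGraph {u : HexVertex | u ∈ (Λ δ) ∧ ∀ y ∈ T, 6 * δ < dist ((δ : ℂ) * hexCenter u) y} (va δ) z),
    L / 8, by positivity, by linarith, ?_, ?_, ?_⟩
  · filter_upwards [master] with δ hm
    obtain ⟨hδ, hδL, hA, hab, hva, hvb, hH₀, hH₁, hlink⟩ := hm
    obtain ⟨hsc, haB, hbB, -, hprec, hΛM, hrows⟩ := hA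
    obtain ⟨heqa, hvaΛ, huaΛ, hadja⟩ := hva_spec δ haB
    obtain ⟨heqb, hvbΛ, hubΛ, hadjb⟩ := hvb_spec δ hbB
    obtain ⟨h1, h2, h3, h4, h5, h6, h7, h8, h9, -⟩ := subFamily_clauses hδ hδL hLρ hflat₁ hΛM
      (hrows 0) (hrows 1) hsc heqa hvaΛ huaΛ hadja heqb hvbΛ hubΛ hadjb hab hTfar₀ hTfar₁ hTdiff
      hTesc hva hvb hH₀ hH₁ hlink
    have hballρ : ∀ {p : ℂ} {z : ℂ}, z ∈ ball p (L / 8) → z ∈ ball p ρ := fun hz =>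
      mem_ball.2 ((mem_ball.1 hz).trans_le (by linarith))
    exact ⟨h1, hsc, h2, hprec, h3, haB, hbB, h4, h5, h6, hΛM, h7,
      fun v hv => ⟨hrows 0 v (hballρ hv), h8 v hv⟩, fun v hv => ⟨hrows 1 v (hballρ hv), h9 v hv⟩⟩
  · intro K hK hKM'
    obtain ⟨εK, hεK, HK⟩ := exists_walk_deep_of_isCompact M'.isOpen M'.isConnected hK hKM' hx₀M'
    obtain ⟨hKc, hKcsub⟩ := isCompact_setOf_le_infDist_compl hM'b (half_pos hεK)
    have eKc := hexh _ hKc (hKcsub.trans hsub)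
    have eδ : ∀ᶠ δ : ℝ in 𝓝[>] 0, δ ≤ εK / 10 := by
      filter_upwards [Ioo_mem_nhdsGT (show (0 : ℝ) < εK / 10 by positivity)] with δ hδ
      exact hδ.2.le
    filter_upwards [master, eKc, eδ] with δ hm hKcδ hδK v hvK
    obtain ⟨hδ, hδL, hA, hab, hva, hvb, hH₀, hH₁, hlink⟩ := hm
    obtain ⟨hsc, haB, hbB, -, -, hΛM, hrows⟩ := hA
    obtain ⟨heqa, hvaΛ, huaΛ, hadja⟩ := hva_spec δ haB
    obtain ⟨heqb, hvbΛ, hubΛ, hadjb⟩ := hvb_spec δ hbB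
    obtain ⟨z₀, hz₀⟩ := exists_vertex_dist_le hδ (p₀ + (L : ℂ) * Complex.I)
    have hz₀Λ' := (subFamily_clauses hδ hδL hLρ hflat₁ hΛM (hrows 0) (hrows 1) hsc heqa hvaΛ huaΛ
      hadja heqb hvbΛ hubΛ hadjb hab hTfar₀ hTfar₁ hTdiff hTesc hva hvb hH₀ hH₁
      hlink).2.2.2.2.2.2.2.2.2 z₀ hz₀
    obtain ⟨w, hw⟩ := HK δ (εK - 4 * δ) hδ (by linarith) z₀ v hz₀ hvK
    exact mem_subFamily_iff.2 ((mem_subFamily_iff.1 hz₀Λ').trans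
      (pathIn_of_walk w fun u hu => walk_deep hδ hδK hKcδ (hw u hu)))
  · intro r hr
    have eδ : ∀ᶠ δ : ℝ in 𝓝[>] 0, 6 * δ < r := by
      filter_upwards [Ioo_mem_nhdsGT (show (0 : ℝ) < r / 6 by positivity)] with δ hδ
      linarith [hδ.2]
    filter_upwards [master, eδ] with δ hm hδr γ hfar v hv
    obtain ⟨-, -, hA, hab, -⟩ := hm
    obtain ⟨heqa, -, huaΛ, -⟩ := hva_spec δ hA.2.1
    exact verts_subset_subFamily_of_far heqa huaΛ hab γ
      (fun v hv y hy => lt_of_lt_of_le hδr (hfar v hv y hy)) v hv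

/-! ### Registry form -/

/-- **Registered sub-goal `stub_twoPieceAdmIdentification_family`** (crux item stmt-CriticalPhenomena-14005, line
`bridge-gate-renewal`, stub `stub_twoPieceAdmIdentification`): registry form of `exists_admissible_subFamily` — the admissible sub-family of a given admissible family for a hull subdomain and an exclusion set. [cite: DuminilCopinSmirnov2012, §4 (before Conjecture 1); LawlerSchrammWerner2004SAW, §3.4] -/
theorem stub_twoPieceAdmIdentification_family :
    ∀ (M M' : DobrushinDomain) (ρ : ℝ) (Λ : ℝ → Finset HexVertex) (m : Fin 2 → ℝ → ℤ)
      (a b : ℝ → Sym2 HexVertex) (T : Set ℂ),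
      (0 < ρ ∧ ∀ i : Fin 2, M.carrier ∩ ball (M.pt i) ρ =
        {z : ℂ | (M.pt i).im < z.im} ∩ ball (M.pt i) ρ) →
      M.IsHullSubdomain M' →
      (∀ᶠ δ : ℝ in 𝓝[>] 0, hexDomainSimplyConnected (Λ δ) ∧ a δ ∈ hexDomainBoundary (Λ δ) ∧
        b δ ∈ hexDomainBoundary (Λ δ) ∧ Nonempty (HexMidEdgeSAW (Λ δ) (a δ) (b δ)) ∧
        (hexGraph.induce (↑(Λ δ) : Set HexVertex)).Preconnected ∧
        (∀ v ∈ Λ δ, (δ : ℂ) * hexCenter v ∈ M.carrier) ∧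
        (∀ i : Fin 2, ∀ v : HexVertex, (δ : ℂ) * hexCenter v ∈ ball (M.pt i) ρ →
          (v ∈ Λ δ ↔ m i δ ≤ v.1 1))) →
      (∀ K : Set ℂ, IsCompact K → K ⊆ M.carrier →
        ∀ᶠ δ : ℝ in 𝓝[>] 0, ∀ v : HexVertex, (δ : ℂ) * hexCenter v ∈ K → v ∈ Λ δ) →
      Tendsto (fun δ : ℝ => (δ : ℂ) * hexMidpoint (a δ)) (𝓝[>] 0) (𝓝 (M.pt 0)) →
      Tendsto (fun δ : ℝ => (δ : ℂ) * hexMidpoint (b δ)) (𝓝[>] 0) (𝓝 (M.pt 1)) →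
      IsCompact T → M.pt 0 ∉ T → M.pt 1 ∉ T → M.carrier \ M'.carrier ⊆ T → Disjoint T M'.carrier →
      (∀ y ∈ T, ∃ Ty ⊆ T, IsPreconnected Ty ∧ y ∈ Ty ∧
        ∃ q ∈ Ty, q.im = (M.pt 1).im ∧ dist q (M.pt 1) < ρ / 4) →
      ∃ (Λ' : ℝ → Finset HexVertex) (ρ' : ℝ), 0 < ρ' ∧ ρ' ≤ ρ ∧
        (∀ᶠ δ : ℝ in 𝓝[>] 0,
          Λ' δ ⊆ Λ δ ∧ hexDomainSimplyConnected (Λ δ) ∧ hexDomainSimplyConnected (Λ' δ) ∧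
          (hexGraph.induce (↑(Λ δ) : Set HexVertex)).Preconnected ∧
          (hexGraph.induce (↑(Λ' δ) : Set HexVertex)).Preconnected ∧
          a δ ∈ hexDomainBoundary (Λ δ) ∧ b δ ∈ hexDomainBoundary (Λ δ) ∧
          a δ ∈ hexDomainBoundary (Λ' δ) ∧ b δ ∈ hexDomainBoundary (Λ' δ) ∧
          Nonempty (HexMidEdgeSAW (Λ' δ) (a δ) (b δ)) ∧
          (∀ v ∈ Λ δ, (δ : ℂ) * hexCenter v ∈ M.carrier) ∧
          (∀ v ∈ Λ' δ, (δ : ℂ) * hexCenter v ∈ M'.carrier) ∧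
          (∀ v : HexVertex, (δ : ℂ) * hexCenter v ∈ ball (M.pt 0) ρ' →
            ((v ∈ Λ δ ↔ m 0 δ ≤ v.1 1) ∧ (v ∈ Λ' δ ↔ m 0 δ ≤ v.1 1))) ∧
          (∀ v : HexVertex, (δ : ℂ) * hexCenter v ∈ ball (M.pt 1) ρ' →
            ((v ∈ Λ δ ↔ m 1 δ ≤ v.1 1) ∧ (v ∈ Λ' δ ↔ m 1 δ ≤ v.1 1)))) ∧
        (∀ K : Set ℂ, IsCompact K → K ⊆ M'.carrier →
          ∀ᶠ δ : ℝ in 𝓝[>] 0, ∀ v : HexVertex, (δ : ℂ) * hexCenter v ∈ K → v ∈ Λ' δ) ∧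
        (∀ r : ℝ, 0 < r → ∀ᶠ δ : ℝ in 𝓝[>] 0, ∀ γ : HexMidEdgeSAW (Λ δ) (a δ) (b δ),
          (∀ v ∈ γ.verts, ∀ y ∈ T, r ≤ dist ((δ : ℂ) * hexCenter v) y) →
            ∀ v ∈ γ.verts, v ∈ Λ' δ) :=
  fun _ _ _ _ _ _ _ _ hflat hM' hadm hexh ha hb hTc hT0 hT1 hTdiff hTdisj hTesc =>
    exists_admissible_subFamily hflat hM' hadm hexh ha hb hTc hT0 hT1 hTdiff hTdisj hTesc

end Summit.CriticalPhenomena.SAWScalingLimit.Theorems.ObservableToSLER.TwoPiece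

end
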